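import Summits.QuantumFields.YangMills.Theorems.QuantileBitPuritySectorGaugeKernel
import Summits.QuantumFields.YangMills.Theorems.QuantileBitPuritySectors
import Summits.QuantumFields.YangMills.Theorems.FemtoTransferGapPositivity
import Literature.Analysis.OperatorTheory.TwistedKernelTraceFormula
import Literature.Analysis.OperatorTheory.CompactSelfAdjointEigenbasis
import HarnessLib

/-!
# A twisted seam sector never outweighs the periodic one: `sectorWeight β n z 1 ≤ sectorWeight β n 0 1`
# (Tomboulis–Yaffe ∕ Kanazawa for the tree's zero-flux ring), hence `Z_phys ≤ W_{+++}` and the PERIODIC-SECTOR DOOR unconditionally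

Support module (`--supports` stmt-QuantumFields-23948, `QuantileBitPurity.HolonomyQuantileSubQuartic`; LINE g12-B of seat ym-idea-4, memo HOME
`bc/g14-dw/SECTORS-translates.md` §0).  Second half (companion `QuantileBitPuritySectorGaugeKernel` supplies `K_β^G` and the twisted-iterate form
`sectorWeight β (m+1) z 1 = ∫ (κ_{K^G}^{[m+1]} K^G(·, x))(tw_z x) dx`):

* §3 positivity: `0 ≤ ⟨ψ, K_β ψ⟩` for every BOUNDED MEASURABLE `ψ` and `β ≥ 0` (the Gram-kernel argument of `FemtoTransferGapPositivity`, whose physical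
  test function was only used through measurability and boundedness), whence every eigenvalue of the `L²` operator of `K_β^G` is `≥ 0`
  (`gaugeKernelOp_eigenvalue_nonneg`: an eigenfunction with `λ ≠ 0` has the bounded gauge-invariant representative `λ⁻¹ ∫ K^G(·,y) φ(y) dy`, on which
  `K_β^G` acts as `K_β`);
* §4 ★ `sectorWeight_one_le_untwisted`: `sectorWeight β (m+1) z 1 ≤ sectorWeight β (m+1) 0 1` for every centre twist `z` (Lit `integral_iterate_twisted_le`
  for `K_β^G` — symmetric, bounded, with a Hilbert eigenbasis of its compact self-adjoint `L²` operator (Lit `exists_kernelOp`,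
  `exists_hilbertBasis_eigenvectors_of_isSelfAdjoint`; countable index by separability) and non-negative eigenvalues — and the measure-preserving
  involution `tw_z`: a twist inserted into one bond never raises the trace of a positive kernel chain, 't Hooft (5.3), Tomboulis–Yaffe, Kanazawa
  Lemma 2); ★ `physTraceSucc_le_sectorWeight_untwisted`: `Z_phys(L, β, m+2) ≤ sectorWeight β (m+1) 0 1` (the zero-flux trace is the AVERAGE of the
  eight sectors); and ★ `ringInsTrace_indicator_le_of_periodic_sector` — the periodic-sector door of `QuantileBitPuritySectors` with its hypothesis `hZ`
  discharged: a periodic-sector estimate `sectorWeight 0 𝟙_A ≤ q₀ · sectorWeight 0 1`, `q₀ ≤ 1`, gives `ringInsTrace 𝟙_A 0 ≤ (1 − (1 − q₀)/8) · Z_phys`.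

HONEST FRAMING: fixed-lattice transfer-matrix positivity; no semiclassics/RG; nothing about infinite volume, the continuum limit or the Clay gap.
No `sorry`, no new axiom, no new definition.  References: [cite: tHooft1979]; [cite: OsterwalderSeiler1978, §2]; [cite: SeilerLNP1982, §3];
[cite: ReedSimonI1980, Thm. VI.16, VI.22–23]; T. Kanazawa, Ann. Phys. 324 (2009) 1634, Lemma 2; E. T. Tomboulis, L. G. Yaffe, CMP 100 (1985) 313.
-/

set_option autoImplicit false

noncomputable section

open MeasureTheory Filter Topology Real Function
open scoped BigOperators InnerProductSpace
open Literature.MathematicalPhysics.QuantumLattice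
open Literature.MathematicalPhysics.QuantumFieldTheory hiding SU2
open Literature.Analysis.OperatorTheory
open Summit.QuantumFields.YangMills.Theorems

namespace Summit.QuantumFields.YangMills.Theorems.FemtoTransferGap.TT

open Summit.QuantumFields.YangMills.Theorems.FemtoTransferGap
open Summit.QuantumFields.YangMills.Theorems.FemtoTransferGap.TwoLattice.TowerA

variable {L : ℕ} [NeZero L]

/-! ## §3 Positivity: `⟨ψ, K_β ψ⟩ ≥ 0` for bounded measurable `ψ`, and the eigenvalues of the `L²` operator of `K_β^G` -/

/-- **The transfer quadratic form is non-negative on every bounded measurable function** (`β ≥ 0`): `ψ(U)K_β(U,V)ψ(V) = Φ(U)e^{βT(U,V)}Φ(V)`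
with `Φ = ψ e^{−(β/2)S}` and `T` the Gram kernel of the fundamental features; Fubini + Gram positivity (`integral_prod_exp_gram_nonneg`).  This
is `qform_self_nonneg_fundamentalRep` with the (unused there) gauge/twist invariance of the test function dropped. [cite: OsterwalderSeiler1978, §2] -/
theorem qform_su2Rep_self_nonneg_of_bounded {β : ℝ} (hβ : 0 ≤ β) {ψ : GaugeConfig 3 L SU2 → ℝ} (hψm : Measurable ψ) {C : ℝ}
    (hC : ∀ U, |ψ U| ≤ C) : 0 ≤ qform su2Rep β ψ ψ := by
  haveI : SecondCountableTopology SU2 := secondCountableTopology_su2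
  have hC0 : 0 ≤ C := (abs_nonneg _).trans (hC fun _ => 1)
  -- the weight `w = e^{−(β/2) S}` and `Φ = ψ w`
  have hw_cont : Continuous fun U : GaugeConfig 3 L SU2 => Real.exp (-(β / 2) * wilsonAction su2Rep U) :=
    Real.continuous_exp.comp (continuous_const.mul (continuous_wilsonAction su2Rep continuous_su2Rep))
  obtain ⟨W, hW⟩ := (isCompact_range hw_cont).bddAbove
  have hWle : ∀ U, Real.exp (-(β / 2) * wilsonAction su2Rep U) ≤ W := fun U => hW (Set.mem_range_self U)
  set Φ : GaugeConfig 3 L SU2 → ℝ := fun U => ψ U * Real.exp (-(β / 2) * wilsonAction su2Rep U) with hΦdef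
  have hΦm : Measurable Φ := hψm.mul hw_cont.measurable
  have hΦb : ∀ U, |Φ U| ≤ C * W := by
    intro U
    rw [hΦdef, abs_mul, abs_of_pos (Real.exp_pos _)]
    exact mul_le_mul (hC U) (hWle U) (Real.exp_pos _).le hC0
  have hCW : 0 ≤ C * W := (abs_nonneg _).trans (hΦb fun _ => 1)
  -- features
  have hgm : ∀ a, Measurable (suFeature 2 L a) := fun a => (continuous_suFeature L a).measurable
  have hgb : ∀ a U, |suFeature 2 L a U| ≤ 1 := abs_suFeature_le_one L
  have hTm : Measurable fun p : GaugeConfig 3 L SU2 × GaugeConfig 3 L SU2 => ∑ a, suFeature 2 L a p.1 * suFeature 2 L a p.2 :=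
    measurable_gram _ hgm
  have hTb := fun p : GaugeConfig 3 L SU2 × GaugeConfig 3 L SU2 => abs_gram_le (suFeature 2 L) zero_le_one hgb p.1 p.2
  -- the integrand identity
  have hK : ∀ U V, ψ U * transferKernel su2Rep β U V * ψ V
      = Φ U * Real.exp (β * ∑ a, suFeature 2 L a U * suFeature 2 L a V) * Φ V := by
    intro U V
    rw [← timeCoupling_fundamentalRep_eq_gram, hΦdef]
    simp only [transferKernel]
    rw [show β * timeCoupling su2Rep U V - β / 2 * (wilsonAction su2Rep U + wilsonAction su2Rep V)
        = β * timeCoupling su2Rep U V + -(β / 2) * wilsonAction su2Rep U + -(β / 2) * wilsonAction su2Rep V by ring,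
      Real.exp_add, Real.exp_add]
    ring
  have hint : Integrable (fun p : GaugeConfig 3 L SU2 × GaugeConfig 3 L SU2 =>
        Φ p.1 * Real.exp (β * ∑ a, suFeature 2 L a p.1 * suFeature 2 L a p.2) * Φ p.2)
      ((configMeasure SU2 L).prod (configMeasure SU2 L)) := by
    refine integrable_sandwich (configMeasure SU2 L)
      (H := fun p => Real.exp (β * ∑ a, suFeature 2 L a p.1 * suFeature 2 L a p.2)) (hTm.const_mul β).exp
      (R := Real.exp (β * (Fintype.card (Edge 3 L × (Fin 2 × Fin 2) × Bool) * 1 ^ 2))) (fun p => ?_) hΦm hΦb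
    show |Real.exp (β * ∑ a, suFeature 2 L a p.1 * suFeature 2 L a p.2)| ≤ _
    rw [abs_of_pos (Real.exp_pos _)]
    refine Real.exp_le_exp.mpr ?_
    exact (le_abs_self _).trans (by rw [abs_mul, abs_of_nonneg hβ]; exact mul_le_mul_of_nonneg_left (hTb p) hβ)
  have hq : qform su2Rep β ψ ψ
      = ∫ p, Φ p.1 * Real.exp (β * ∑ a, suFeature 2 L a p.1 * suFeature 2 L a p.2) * Φ p.2
          ∂(configMeasure SU2 L).prod (configMeasure SU2 L) := by
    unfold qform
    simp_rw [hK]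
    exact (integral_prod _ hint).symm
  rw [hq]
  exact integral_prod_exp_gram_nonneg (configMeasure SU2 L) (suFeature 2 L) hgm zero_le_one hgb Φ hΦm hCW hΦb hβ

/-- **Eigenvalues of the `L²` operator of `K_β^G` are non-negative** (`β ≥ 0`).  An eigenfunction `φ` with `A φ = λ φ`, `λ ≠ 0`, agrees a.e. with the
bounded, measurable, GAUGE-INVARIANT function `ψ = λ⁻¹ ∫ K_β^G(·, y) φ(y) dy`; then `λ‖φ‖² = ⟨φ, Aφ⟩ = ∫∫ ψ K_β^G ψ = ∫∫ ψ K_β ψ ≥ 0`.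
[cite: ReedSimonI1980, Thm. VI.16] [cite: OsterwalderSeiler1978, §2] -/
theorem gaugeKernelOp_eigenvalue_nonneg {β : ℝ} (hβ : 0 ≤ β) {A : Lp ℝ 2 (configMeasure SU2 L) →L[ℝ] Lp ℝ 2 (configMeasure SU2 L)}
    (hA : ∀ φ : Lp ℝ 2 (configMeasure SU2 L),
      (A φ : GaugeConfig 3 L SU2 → ℝ) =ᵐ[configMeasure SU2 L] fun x => ∫ y, gaugeKernel β x y * φ y ∂configMeasure SU2 L)
    {φ : Lp ℝ 2 (configMeasure SU2 L)} {lam : ℝ} (hφ : A φ = lam • φ) (hlam : lam = ⟪φ, A φ⟫_ℝ) : 0 ≤ lam := by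
  by_cases h0 : lam = 0
  · rw [h0]
  obtain ⟨M, hM0, hM⟩ := exists_abs_transferKernel_le (L := L) β
  have hKG : StronglyMeasurable (uncurry fun U V : GaugeConfig 3 L SU2 => gaugeKernel β U V) := stronglyMeasurable_gaugeKernel β
  have hCG : ∀ x y : GaugeConfig 3 L SU2, ‖gaugeKernel β x y‖ ≤ M := fun x y => by
    rw [Real.norm_eq_abs]; exact abs_gaugeKernel_le hM x y
  -- the bounded gauge-invariant representative
  set c : GaugeConfig 3 L SU2 → ℝ := fun x => ∫ y, gaugeKernel β x y * φ y ∂configMeasure SU2 L with hcdef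
  have hcm : Measurable c := (stronglyMeasurable_integral_kernel_mul (𝕜 := ℝ) hKG φ).measurable
  have hcb : ∀ x, |c x| ≤ M * Real.sqrt ((configMeasure SU2 L).real Set.univ) * ‖φ‖ := fun x => abs_integral_kernel_mul_le hCG hM0 φ x
  have hcg : ∀ (g : Site 3 L → SU2) (x : GaugeConfig 3 L SU2), c (gaugeTransform g x) = c x := fun g x => by
    simp only [hcdef]
    refine integral_congr_ae (ae_of_all _ fun y => ?_)
    dsimp only
    rw [gaugeKernel_gaugeTransform_left]
  set ψ : GaugeConfig 3 L SU2 → ℝ := fun x => lam⁻¹ * c x with hψdef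
  have hψm : Measurable ψ := hcm.const_mul _
  have hψb : ∀ x, |ψ x| ≤ |lam⁻¹| * (M * Real.sqrt ((configMeasure SU2 L).real Set.univ) * ‖φ‖) := fun x => by
    rw [hψdef, abs_mul]; exact mul_le_mul_of_nonneg_left (hcb x) (abs_nonneg _)
  have hψg : ∀ (g : Site 3 L → SU2) (x : GaugeConfig 3 L SU2), ψ (gaugeTransform g x) = ψ x := fun g x => by
    simp only [hψdef, hcg]
  -- `φ = ψ` a.e.
  have hae : (φ : GaugeConfig 3 L SU2 → ℝ) =ᵐ[configMeasure SU2 L] ψ := by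
    have h1 : ((lam • φ : Lp ℝ 2 (configMeasure SU2 L)) : GaugeConfig 3 L SU2 → ℝ) =ᵐ[configMeasure SU2 L] c := hφ ▸ hA φ
    filter_upwards [h1, Lp.coeFn_smul lam φ] with x hx1 hx2
    rw [hx2, Pi.smul_apply, smul_eq_mul] at hx1
    simp only [hψdef]
    rw [← hx1, ← mul_assoc, inv_mul_cancel₀ h0, one_mul]
  -- `lam = ⟨φ, Aφ⟩ = ∫∫ ψ K_β^G ψ = ∫∫ ψ K_β ψ ≥ 0`
  have h2 : ⟪φ, A φ⟫_ℝ = ∫ x, ψ x * ∫ y, transferKernel su2Rep β x y * ψ y ∂configMeasure SU2 L ∂configMeasure SU2 L := by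
    rw [inner_kernelOp_eq_integral hA φ φ]
    have hin : ∀ x, ∫ y, gaugeKernel β x y * φ y ∂configMeasure SU2 L = ∫ y, gaugeKernel β x y * ψ y ∂configMeasure SU2 L := fun x =>
      integral_congr_ae (by filter_upwards [hae] with y hy; rw [hy])
    refine integral_congr_ae ?_
    filter_upwards [hae] with x hx
    rw [hx, hin x, integral_gaugeKernel_mul_of_gaugeInv β hψm hψb hψg x]
  have h3 : ∫ x, ψ x * ∫ y, transferKernel su2Rep β x y * ψ y ∂configMeasure SU2 L ∂configMeasure SU2 L = qform su2Rep β ψ ψ := by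
    unfold qform
    refine integral_congr_ae (ae_of_all _ fun x => ?_)
    dsimp only
    rw [← integral_const_mul]
    refine integral_congr_ae (ae_of_all _ fun y => ?_)
    ring
  rw [hlam, h2, h3]
  exact qform_su2Rep_self_nonneg_of_bounded hβ hψm hψb

/-! ## §4 The twist inequality and the periodic-sector door, unconditional -/

/-- ★ **A twisted seam sector never outweighs the periodic one**: `sectorWeight β (m+1) z 1 ≤ sectorWeight β (m+1) 0 1` for every centre twist `z`
and every `β ≥ 0` (ring of `m+2 ≥ 2` kernels).  Lit `integral_iterate_twisted_le` for the gauge-averaged kernel `K_β^G` (symmetric, bounded, with a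
Hilbert eigenbasis of its compact self-adjoint `L²` operator and non-negative eigenvalues) and the measure-preserving twist `tw_z`: 't Hooft's
`Tr T_z e^{−βH} = Σ_n e^{−βE_n}⟨n|T_z|n⟩ ≤ Tr e^{−βH}` — the Tomboulis–Yaffe ∕ Kanazawa inequality `Z^{tw} ≤ Z`. [cite: tHooft1979] [cite: ReedSimonI1980, Thm. VI.22–23] -/
theorem sectorWeight_one_le_untwisted {β : ℝ} (hβ : 0 ≤ β) (m : ℕ) (z : Fin 3 → Bool) :
    sectorWeight (L := L) β (m + 1) z (fun _ _ => (1 : ℝ)) ≤ sectorWeight (L := L) β (m + 1) (fun _ => false) (fun _ _ => (1 : ℝ)) := by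
  classical
  haveI : SecondCountableTopology SU2 := secondCountableTopology_su2
  haveI : Fact ((2 : ENNReal) ≠ ⊤) := ⟨ENNReal.ofNat_ne_top⟩
  obtain ⟨M, hM0, hM⟩ := exists_abs_transferKernel_le (L := L) β
  have hKG : StronglyMeasurable (uncurry fun U V : GaugeConfig 3 L SU2 => gaugeKernel β U V) := stronglyMeasurable_gaugeKernel β
  have hCG : ∀ x y : GaugeConfig 3 L SU2, ‖gaugeKernel β x y‖ ≤ M := fun x y => by
    rw [Real.norm_eq_abs]; exact abs_gaugeKernel_le hM x y
  have hsymm : ∀ x y : GaugeConfig 3 L SU2, gaugeKernel β x y = gaugeKernel β y x := gaugeKernel_symm β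
  obtain ⟨A, hA⟩ := exists_kernelOp (μ := configMeasure SU2 L) hKG hCG
  have hsa := isSelfAdjoint_kernelOp hKG hCG hsymm hA
  have hcpt := isCompactOperator_kernelOp hCG hM0 hA
  obtain ⟨s, b, κ, hbcoe, hb⟩ := exists_hilbertBasis_eigenvectors_of_isSelfAdjoint hcpt hsa
  have hb' : ∀ i, A (b i) = κ i • b i := fun i => by simpa using hb i
  -- the index set is countable (`L²` of the compact metrisable configuration space is separable)
  have hon : Orthonormal ℝ ((↑) : s → Lp ℝ 2 (configMeasure SU2 L)) := hbcoe ▸ b.orthonormal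
  haveI : Countable s := (hon.countable_of_separableSpace (𝕜 := ℝ)).to_subtype
  have hlam : ∀ i, 0 ≤ κ i := fun i => gaugeKernelOp_eigenvalue_nonneg (L := L) hβ hA (hb' i) (lam_eq_inner hb' i)
  have key := integral_iterate_twisted_le (μ := configMeasure SU2 L) hKG hCG hsymm hA hb' hlam (measurePreserving_twist3 (L := L) z) m
  rw [sectorWeight_one_eq_integral_iterate_twisted, sectorWeight_one_eq_integral_iterate_twisted]
  simpa only [twist3_false] using key

/-- ★ **The zero-flux trace is at most the periodic sector**: `Z_phys(L, β, m+2) = (1/8) Σ_z sectorWeight β (m+1) z 1 ≤ sectorWeight β (m+1) 0 1`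
(`β ≥ 0`).  This is the hypothesis `hZ` of the periodic-sector door `TT.ringInsTrace_indicator_le_of_periodic`. [cite: tHooft1979] [cite: MontvayMunster1994, (3.145)] -/
theorem physTraceSucc_le_sectorWeight_untwisted {β : ℝ} (hβ : 0 ≤ β) (m : ℕ) :
    physTraceSucc L β (m + 1) ≤ sectorWeight (L := L) β (m + 1) (fun _ => false) (fun _ _ => (1 : ℝ)) := by
  rw [physTraceSucc_eq_sum_sectorWeight]
  have h : ∑ z : Fin 3 → Bool, sectorWeight (L := L) β (m + 1) z (fun _ _ => (1 : ℝ)) ≤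
      ∑ _z : Fin 3 → Bool, sectorWeight (L := L) β (m + 1) (fun _ => false) (fun _ _ => (1 : ℝ)) :=
    Finset.sum_le_sum fun z _ => sectorWeight_one_le_untwisted hβ m z
  rw [Finset.sum_const, Finset.card_univ, card_twists] at h
  have h8 : ((8 : ℕ) • sectorWeight (L := L) β (m + 1) (fun _ => false) (fun _ _ => (1 : ℝ))) =
      8 * sectorWeight (L := L) β (m + 1) (fun _ => false) (fun _ _ => (1 : ℝ)) := by rw [nsmul_eq_mul]; norm_num
  rw [h8] at h
  linarith

/-- ★ **THE PERIODIC-SECTOR DOOR, unconditional** (ring of `m+2 ≥ 2` kernels, `β ≥ 0`): if INSIDE THE PERIODIC SECTOR the slice event `A` carries at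
most the fraction `q₀ ≤ 1` of the weight, `sectorWeight β (m+1) 0 𝟙_A(U₀) ≤ q₀ · sectorWeight β (m+1) 0 1`, then its zero-flux thermal weight obeys
`ringInsTrace L β (m+1) 𝟙_A 0 ≤ (1 − (1 − q₀)/8) · Z_phys(L, β, m+2)` — any `q₀ < 1` gives a thermal fraction `< 1`, whatever the seven twisted
sectors do.  (For `QuantileBitPurity.HolonomyQuantileSubQuartic`: `m + 2 = L`, `A` = the holonomy core.) [cite: tHooft1979] [cite: MontvayMunster1994, (3.145)] -/
theorem ringInsTrace_indicator_le_of_periodic_sector {β : ℝ} (hβ : 0 ≤ β) (m : ℕ) {A : Set (GaugeConfig 3 L SU2)} (hA : MeasurableSet A)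
    {q₀ : ℝ} (hq₀ : q₀ ≤ 1)
    (hq : sectorWeight β (m + 1) (fun _ => false) (fun Us _ => A.indicator (fun _ => (1 : ℝ)) (Us 0)) ≤
      q₀ * sectorWeight (L := L) β (m + 1) (fun _ => false) fun _ _ => (1 : ℝ)) :
    ringInsTrace L β (m + 1) (A.indicator fun _ => (1 : ℝ)) 0 ≤ (1 - (1 - q₀) / 8) * physTraceSucc L β (m + 1) :=
  ringInsTrace_indicator_le_of_periodic hβ (m + 1) hA hq₀ (physTraceSucc_le_sectorWeight_untwisted hβ m) hq

end Summit.QuantumFields.YangMills.Theorems.FemtoTransferGap.TT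

end
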